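import Mathlib
import Literature.Analysis.FunctionSpaces.PoissonPointProcess

/-!
# Stub `stub_spinSelection` — line `Sketch`, crux `VoronoiHubFromSmirnov` (stmt-CriticalPhenomena-6433)

The isotropy selection rule for means (card annealed-morera-palm-defect, first lemma): a spin-`m`
(`m ≠ 0`) rotation-covariant integrable functional of a point configuration has zero mean under any
rotation-invariant probability law.  Proof: by invariance of the law and the change-of-variables
formula, `∫ Ψ = ∫ Ψ ∘ rot θ = e^{imθ} ∫ Ψ` for every `θ`; at `θ = π / m` the phase is `e^{iπ} = -1`.
-/

open MeasureTheory Complex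

namespace Summit.CriticalPhenomena.CardyFormulaZ2.Cruxes.VoronoiHubFromSmirnov.SketchLine

open Literature.Analysis.FunctionSpaces

/-- **Isotropy selection rule** (card annealed-morera-palm-defect of crux `VoronoiHubFromSmirnov`,
first lemma): if the probability law `P` on point configurations of `ℂ` is invariant under the
rotations `rot θ` and `Ψ` is an integrable functional of spin `m ≠ 0`
(`Ψ (rot θ c) = e^{imθ} Ψ c`), then `∫ Ψ dP = 0`.  (The membership characterisation `hrot` of the
rotations is part of the registered signature but is not needed for the proof.) -/
theorem stub_spinSelection (P : Measure (PointConfig ℂ)) [IsProbabilityMeasure P]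
    (rot : ℝ → PointConfig ℂ → PointConfig ℂ)
    (_hrot : ∀ θ (c : PointConfig ℂ) (z : ℂ), z ∈ rot θ c ↔ exp (-(θ : ℂ) * I) * z ∈ c)
    (hmeas : ∀ θ, Measurable (rot θ)) (hinv : ∀ θ, P.map (rot θ) = P)
    (m : ℤ) (hm : m ≠ 0) (Ψ : PointConfig ℂ → ℂ) (hΨ : Integrable Ψ P)
    (hspin : ∀ θ c, Ψ (rot θ c) = exp ((m : ℂ) * (θ : ℂ) * I) * Ψ c) :
    ∫ c, Ψ c ∂P = 0 := by
  -- the angle `θ = π / m` has phase `e^{i m θ} = e^{iπ} = -1`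
  set θ : ℝ := Real.pi / m with hθ
  have hphase : exp ((m : ℂ) * (θ : ℂ) * I) = -1 := by
    have hm' : (m : ℂ) ≠ 0 := by exact_mod_cast hm
    have : (m : ℂ) * (θ : ℂ) = Real.pi := by
      rw [hθ]
      push_cast
      field_simp
    rw [this, Complex.exp_pi_mul_I]
  -- change of variables under the measure-preserving rotation
  have hcv : ∫ c, Ψ c ∂P = ∫ c, Ψ (rot θ c) ∂P := by
    have hae : AEStronglyMeasurable Ψ (P.map (rot θ)) := by
      rw [hinv θ]; exact hΨ.aestronglyMeasurable
    rw [← integral_map (hmeas θ).aemeasurable hae, hinv θ]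
  -- now `∫ Ψ = -1 * ∫ Ψ`
  have h2 : ∫ c, Ψ c ∂P = -1 * ∫ c, Ψ c ∂P := by
    have := hcv
    simp_rw [hspin θ, hphase] at this
    rwa [integral_const_mul] at this
  have h3 : (2 : ℂ) * ∫ c, Ψ c ∂P = 0 := by linear_combination h2
  simpa using h3

end Summit.CriticalPhenomena.CardyFormulaZ2.Cruxes.VoronoiHubFromSmirnov.SketchLine
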